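import Summits.QuantumFields.YangMills.Theorems.UnitScaleTiltProp7HfRealityTrace
import HarnessLib

/-!
# Route `UnitScaleTilt`, crux K1 child «MinimiserStabilityRegPr» (stmt-QuantumFields-19200), skeleton v10, stub `stub_existenceMinimalOrbit` (EX),
# route (α) — **THE (R-𝒢) CLAUSE: PRINT'S `𝔊 = G𝔓*` ((3.147), (3.153); [Balaban1985Variational] (111)) AT AN ARBITRARY HESSIAN SLOT `Δx` MAPS HERMITIAN TRACELESS
# (−3)-DATA TO HERMITIAN TRACELESS (115)-FIELDS** — the EX knit's displayed row `h𝒢R` (✓`Prop7StubEXOfChartPiecesTwS3.stubEX_of_chartPiecesTwS3` :168) at its supplier of record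
# `𝒢f L i U₀ := Prop7SectET3CurvedPropagators.frakGfR … Δx U₀`, given the slot's two rows (σ-commutation; traceless sector + symmetry); unconditional at the slot `Δ^η` for `U₀ ∈ 𝔘_k(ε₀)`

Cell `ym3-torus`, width seat `ym-ust-20520-w4` (gen 5).  THEOREMS ONLY (0 `def`, 0 `sorry`).  The `𝔊`-twin of the seat's `H`-chain (✓`Prop7SectET3PropagatorsReality` §3 `GT_comm`∕`KinvT_comm`∕
`HT_comm`, ✓`Prop7H46Reality.HT_star_comm`, ✓`Prop7HfRealityTrace.trace_Hf_eq_zero_of_traceless`∕`H1f_isHermitian_traceless`): the Hilbert-level total letter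
`frakGT … Δx U₀ = frakGLin G Q_k Q_k† (QGQ*)⁻¹ D R_S D*` (`𝔊x = Gx − GQ*(QGQ*)⁻¹QGx − GDRD*Gx`) commutes with every jointly (anti-)unitary additive involution triple its data commute with
(p03's lit ✓`B11Eq103H1ComplexReality.frakGLin_map_comm` over the seat's comm rows); read at the conjugation triple (p03 ✓`Prop7SectET3HilbertLettersReality`) this is the `IsHermitian` half, at the reflections of the traceless sectors
(✓`Prop7H46RealityTrace`) the `trace` half; ✓`jet_frakGfR_eq` carries both to the (115)-reader `frakGfR` of the knit's binder type.  Nothing here closes the stub;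
`--supports stmt-QuantumFields-19200 --as helper`, count-neutral.  YM₃ on T³ is a ladder rung (R3), not the Clay problem; nothing here claims the stub, the crux, d = 4 or the gap.

THE PRINT.  [Balaban1985BackgroundPropagators] (3.147) p. 425 `𝔓 = I − GQ*(QGQ*)⁻¹Q − GDRD*`, (3.153) p. 426 `𝔊 = G𝔓*`, p. 393 «The operators … are real»; [Balaban1985Variational] (110)–(111)
p. 294 «the operator G₁𝔓* is equal to the operator 𝔊», (115)–(117) pp. 294–295, (51) p. 286 «for A′ with values in 𝔤 the configuration … has values in 𝔤 also».

WHAT IS PROVED (sorry-free, no definition), member `F`, `h : n ≤ K`, weights `c₀ cB`, `a`, slot `Δx`, background `U₀`: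
* §1 ★`frakGT_comm` — `𝔊(U₀)` commutes with any jointly (anti-)unitary additive involution triple `(σ_E, σ_S, σ_F)` commuting with real scalars and with `D_{U₀}`, `Q(U₀)`, `Δx U₀`
  (the `hkind` package of ✓`Prop7SectET3PropagatorsReality` §3);
* §2 ★`frakGT_star_comm (hQ) (hΔx)` (conjugation triple), ★`frakGT_toL2_star_comm` (route-carrier reading: `toL2⁻¹(𝔊(toL2 Aᴴ)) = (toL2⁻¹(𝔊(toL2 A)))ᴴ`);
* §3 ★★`trace_frakGT_toL2_eq_zero_of_traceless (hQtr) (hQsc) (hΔtr) (hΔsymm)` (reflection triple: traceless `A` ↦ traceless `toL2⁻¹(𝔊(toL2 A))`);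
* §4 `jet_frakGfR_eq_toL2` (the reader of record through the route carriers), ★★★`frakGfR_isHermitian_traceless (Δx) (U₀) (hQ) (hΔx) (hQtr) (hQsc) (hΔtr) (hΔsymm)` = the knit's `h𝒢R`
  clause SHAPE at any slot, ★★★`frakGfR_isHermitian_traceless_at_regPr (Δx) (hε₀ he hWe hWε) (U₀) (hreg) (hΔx) (hΔtr) (hΔsymm)` (the `QTwS` rows BY NAME from ★w5's
  ✓`Prop7QTwSRealityOfRegPr`), ★★★`frakGfR_isHermitian_traceless_at_regPr_DeltaEtaSlot` — UNCONDITIONAL at the slot `Δ^η`.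
The `Δ₁`-slot instance (print's `𝔊 = G₁𝔓*` proper, letter of record ✓`Prop7SectET3DeltaOne.frakGfOne … T_J U₀`) is `…_at_regPr` at `Δx := DeltaOne … T_J` with p01's three `Δ₁` rows — a sibling.

References: T. Bałaban, CMP 99 (1985) 389–434 [Balaban1985BackgroundPropagators] ((3.147) p.425, (3.153) p.426, p.393); CMP 102 (1985) 277–309 [Balaban1985Variational] ((110)–(111) p.294,
(115)–(117) pp.294–295, (51) p.286).
-/

set_option autoImplicit false

noncomputable section

open scoped InnerProductSpace ComplexConjugate Matrix.Norms.L2Operator BigOperators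

namespace Summit.QuantumFields.YangMills.Theorems.Prop7FrakGReality

open Literature.MathematicalPhysics.QuantumFieldTheory.Balaban1983to89
open Literature.MathematicalPhysics.QuantumFieldTheory.Balaban1983to89.T3ContinuumYM3Torus
open T3SectALandauChart (eta eta_pos)
open T3PrintedRegularMinimiser (RegPr)
open B9SectCLatticeCarrier (Bond)
open B9Eq311L2Pairing (WL2)
open B11Eq103H1Complex (SiteL2K BondL2K funEquiv funEquiv_apply funEquiv_symm_apply)
open B11Eq115Space (NegSize JetSup NegSup)
open B11Eq103H1ComplexReality (frakGLin_map_comm)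
open Summit.QuantumFields.YangMills.Theorems.Prop7SectET3Transport (periodsT3 siteEquiv bondEquiv bgOfCfg)
open Summit.QuantumFields.YangMills.Theorems.Prop7SectET3HilbertLetters (W₂ frobEquiv toL2 toL2S toL2B QL2 DL2 DstarL2 QL2_toL2 inner_toL2 inner_toL2B adjoint_DL2 toL2_symm_apply)
open Summit.QuantumFields.YangMills.Theorems.Prop7SectET3GaugeProjector (RS)
open Summit.QuantumFields.YangMills.Theorems.Prop7SectET3CurvedPropagators (Qk GT KinvT frakGT frakGfR jet_frakGfR_eq)
open Summit.QuantumFields.YangMills.Theorems.Prop7SectET3WilsonHessian (DeltaEta DeltaEtaSlot DeltaEta_isSymmetric DeltaEta_toL2_star)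
open Summit.QuantumFields.YangMills.Theorems.Prop7SymAvgTwSym (QTwS QTwS_star_comm_of_regPr QTwS_scalar_of_regPr QTwS_traceless_of_regPr)
open Summit.QuantumFields.YangMills.Theorems.Prop7SectET3PropagatorsReality (DstarL2_comm' Qk_comm adjoint_Qk_comm RS_comm GT_comm KinvT_comm)
open Summit.QuantumFields.YangMills.Theorems.Prop7SectET3HilbertLettersReality (toL2_star_star toL2_star_add toL2_star_smul_real inner_toL2_star toL2S_star_star toL2S_star_add
  toL2S_star_smul_real inner_toL2S_star toL2B_star_star toL2B_star_add toL2B_star_smul_real inner_toL2B_star DL2_star_comm QL2_star_comm_of trace_DL2_apply_eq_zero)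
open Summit.QuantumFields.YangMills.Theorems.Prop7H46RealityTrace (reflection_comm_of_mapsTo mapsTo_orthogonal_of_adjoint exists_smul_one_of_trace_orthogonal trace_conjTranspose_mul_smul_one
  trace_DstarL2_apply_eq_zero)
open Summit.QuantumFields.YangMills.Theorems.Prop7WilsonHessianSectorRows (trace_DeltaEta_toL2_eq_zero)

variable (F : T3Family) (n K : ℕ) (h : n ≤ K) (c₀ cB a : ℝ) [Fact (0 < c₀)] [Fact (0 < cB)]
variable (U₀ : GaugeField (F.P K) 0 (Matrix.specialUnitaryGroup (Fin 2) ℂ))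

/-! ## §1 `𝔊 = G𝔓*` commutes with every (anti-)unitary involution triple its data commute with -/

section Generic

variable (σE : BondL2K ℂ 3 (periodsT3 F K) c₀ W₂ → BondL2K ℂ 3 (periodsT3 F K) c₀ W₂)
variable (σS : SiteL2K ℂ 3 (periodsT3 F K) c₀ W₂ → SiteL2K ℂ 3 (periodsT3 F K) c₀ W₂)
variable (σF : WL2 ℂ (fun _ : PBond (F.P n) 0 => cB) W₂ → WL2 ℂ (fun _ : PBond (F.P n) 0 => cB) W₂)
variable (Δx : GaugeField (F.P K) 0 (Matrix.specialUnitaryGroup (Fin 2) ℂ) → (BondL2K ℂ 3 (periodsT3 F K) c₀ W₂ →ₗ[ℂ] BondL2K ℂ 3 (periodsT3 F K) c₀ W₂))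

variable (hkind : ((∀ x y : BondL2K ℂ 3 (periodsT3 F K) c₀ W₂, ⟪σE x, σE y⟫_ℂ = ⟪y, x⟫_ℂ) ∧ (∀ x y : SiteL2K ℂ 3 (periodsT3 F K) c₀ W₂, ⟪σS x, σS y⟫_ℂ = ⟪y, x⟫_ℂ) ∧
      (∀ x y : WL2 ℂ (fun _ : PBond (F.P n) 0 => cB) W₂, ⟪σF x, σF y⟫_ℂ = ⟪y, x⟫_ℂ)) ∨
    ((∀ x y : BondL2K ℂ 3 (periodsT3 F K) c₀ W₂, ⟪σE x, σE y⟫_ℂ = ⟪x, y⟫_ℂ) ∧ (∀ x y : SiteL2K ℂ 3 (periodsT3 F K) c₀ W₂, ⟪σS x, σS y⟫_ℂ = ⟪x, y⟫_ℂ) ∧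
      (∀ x y : WL2 ℂ (fun _ : PBond (F.P n) 0 => cB) W₂, ⟪σF x, σF y⟫_ℂ = ⟪x, y⟫_ℂ)))
  (hEadd : ∀ x y, σE (x + y) = σE x + σE y) (hSadd : ∀ x y, σS (x + y) = σS x + σS y) (hFadd : ∀ x y, σF (x + y) = σF x + σF y)
  (hE2 : ∀ x, σE (σE x) = x) (hS2 : ∀ s, σS (σS s) = s) (hF2 : ∀ y, σF (σF y) = y)
  (hFsmul : ∀ (r : ℝ) (y : WL2 ℂ (fun _ : PBond (F.P n) 0 => cB) W₂), σF (((r : ℝ) : ℂ) • y) = ((r : ℝ) : ℂ) • σF y)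
  (hD : ∀ s, DL2 F n K c₀ U₀ (σS s) = σE (DL2 F n K c₀ U₀ s))
  (hQ : ∀ x, QL2 F n K h c₀ cB U₀ (σE x) = σF (QL2 F n K h c₀ cB U₀ x))
  (hΔx : ∀ x, Δx U₀ (σE x) = σE (Δx U₀ x))

include hkind hEadd hSadd hFadd hE2 hS2 hF2 hFsmul hD hQ hΔx in
/-- ★ **`𝔊 = G𝔓* = G − GQ*(QGQ*)⁻¹QG − GDRD*G` ((3.147)∕(3.153); the `𝔊` of (111)) IS REAL WITH ITS DATA**: it commutes with every jointly (anti-)unitary additive involution triple that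
`D_{U₀}`, `Q(U₀)` and the slot `Δx U₀` commute with — `G`, `(QGQ*)⁻¹`, `Q_k`, `Q_k†`, `R_S`, `D*` commute by ✓`Prop7SectET3PropagatorsReality`, assembled by p03's lit ✓`B11Eq103H1ComplexReality.frakGLin_map_comm`.
[cite: Balaban1985BackgroundPropagators, (3.147) p.425, (3.153) p.426, p.393; Balaban1985Variational, (110)–(111) p.294, (51) p.286] -/
theorem frakGT_comm (x : BondL2K ℂ 3 (periodsT3 F K) c₀ W₂) : frakGT F n K h c₀ cB a Δx U₀ (σE x) = σE (frakGT F n K h c₀ cB a Δx U₀ x) := by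
  have hDs := DstarL2_comm' F n K c₀ cB U₀ σE σS σF hkind hE2 hS2 hD
  have hG := GT_comm F n K h c₀ cB a U₀ σE σS σF Δx hkind hEadd hSadd hFadd hE2 hS2 hF2 hFsmul hD hQ hΔx
  have hKi := KinvT_comm F n K h c₀ cB a U₀ σE σS σF Δx hkind hEadd hSadd hFadd hE2 hS2 hF2 hFsmul hD hQ hΔx
  have hQk := Qk_comm F n K h c₀ cB U₀ σE σF hFsmul hQ
  have hQa := adjoint_Qk_comm F n K h c₀ cB U₀ σE σS σF hkind hE2 hF2 hFsmul hQ
  have hR := RS_comm F n K h c₀ cB U₀ σE σS σF hkind hSadd hFadd hE2 hS2 hD hQ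
  rw [frakGT]
  exact frakGLin_map_comm hEadd hG hKi hD hR hDs hQk hQa x

end Generic

/-! ## §2 The `star` half: `𝔊(U₀)` commutes with `X ↦ Xᴴ` (conjugation triple of ✓`Prop7SectET3HilbertLettersReality`) -/

section Star

variable (Δx : GaugeField (F.P K) 0 (Matrix.specialUnitaryGroup (Fin 2) ℂ) → (BondL2K ℂ 3 (periodsT3 F K) c₀ W₂ →ₗ[ℂ] BondL2K ℂ 3 (periodsT3 F K) c₀ W₂))
  (hQ : ∀ A : PBond (F.P K) 0 → Matrix (Fin 2) (Fin 2) ℂ, QTwS F n K h U₀ (star A) = star (QTwS F n K h U₀ A))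
  (hΔx : ∀ f : BondL2K ℂ 3 (periodsT3 F K) c₀ W₂, Δx U₀ (toL2 F K c₀ (star ((toL2 F K c₀).symm f))) = toL2 F K c₀ (star ((toL2 F K c₀).symm (Δx U₀ f))))

include hQ hΔx in
/-- ★ **`𝔊(U₀)` AT THE SLOT `Δx` COMMUTES WITH THE CONJUGATION** (Hilbert level): §1 at p03's anti-unitary triple `σ := toL2∘star∘toL2⁻¹` (and the site ∕ block twins), the data rows
✓`DL2_star_comm`, ✓`QL2_star_comm_of hQ`, and the slot's σ-row `hΔx`. [cite: Balaban1985BackgroundPropagators, (3.153) p.426, p.393; Balaban1985Variational, (111) p.294, (51) p.286] -/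
theorem frakGT_star_comm (f : BondL2K ℂ 3 (periodsT3 F K) c₀ W₂) :
    frakGT F n K h c₀ cB a Δx U₀ (toL2 F K c₀ (star ((toL2 F K c₀).symm f))) = toL2 F K c₀ (star ((toL2 F K c₀).symm (frakGT F n K h c₀ cB a Δx U₀ f))) :=
  frakGT_comm F n K h c₀ cB a U₀ (fun f => toL2 F K c₀ (star ((toL2 F K c₀).symm f))) (fun g => toL2S F K c₀ (star ((toL2S F K c₀).symm g)))
    (fun y => toL2B F n cB (star ((toL2B F n cB).symm y))) Δx (Or.inl ⟨inner_toL2_star, inner_toL2S_star, inner_toL2B_star⟩)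
    toL2_star_add toL2S_star_add toL2B_star_add toL2_star_star toL2S_star_star toL2B_star_star toL2B_star_smul_real (DL2_star_comm U₀) (QL2_star_comm_of U₀ hQ) hΔx f

include hQ hΔx in
/-- ★ **ROUTE-CARRIER READING: `toL2⁻¹(𝔊(U₀)(toL2 Aᴴ)) = (toL2⁻¹(𝔊(U₀)(toL2 A)))ᴴ`** (pointwise conjugate transpose of functions on the route's bonds).
[cite: Balaban1985Variational, (111) p.294, (51) p.286] -/
theorem frakGT_toL2_star_comm (A : PBond (F.P K) 0 → Matrix (Fin 2) (Fin 2) ℂ) :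
    (toL2 F K c₀).symm (frakGT F n K h c₀ cB a Δx U₀ (toL2 F K c₀ (star A))) = star ((toL2 F K c₀).symm (frakGT F n K h c₀ cB a Δx U₀ (toL2 F K c₀ A))) := by
  have key := frakGT_star_comm F n K h c₀ cB a U₀ Δx hQ hΔx (toL2 F K c₀ A)
  rw [LinearEquiv.symm_apply_apply] at key
  rw [key, LinearEquiv.symm_apply_apply]

include hQ hΔx in
/-- ★ **HERMITIAN `A` GIVE A HERMITIAN `toL2⁻¹(𝔊(U₀)(toL2 A))`.** [cite: Balaban1985Variational, (111) p.294, (51) p.286] -/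
theorem frakGT_toL2_isHermitian_of_isHermitian (A : PBond (F.P K) 0 → Matrix (Fin 2) (Fin 2) ℂ) (hA : ∀ b, (A b).IsHermitian) (b : PBond (F.P K) 0) :
    ((toL2 F K c₀).symm (frakGT F n K h c₀ cB a Δx U₀ (toL2 F K c₀ A)) b).IsHermitian := by
  have hA' : star A = A := funext fun b => by rw [Pi.star_apply, Matrix.star_eq_conjTranspose, (hA b).eq]
  have key := frakGT_toL2_star_comm F n K h c₀ cB a U₀ Δx hQ hΔx A
  rw [hA'] at key
  have hb := congrFun key b
  rw [Pi.star_apply] at hb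
  rw [Matrix.IsHermitian, ← Matrix.star_eq_conjTranspose]
  exact hb.symm

end Star

/-! ## §3 The `trace` half: `𝔊(U₀)` maps traceless fields to traceless fields (reflection triple of ✓`Prop7H46RealityTrace`) -/

/-- ★★ **`𝔊(U₀)` AT ANY SYMMETRIC SLOT MAPS TRACELESS VECTOR FIELDS TO TRACELESS VECTOR FIELDS** (route carriers, read through `toL2`): reflections of the traceless sectors of the three
`L²` carriers intertwined by the data `D_{U₀}` (p03 ✓`trace_DL2_apply_eq_zero` + ✓`trace_DstarL2_apply_eq_zero` via the adjoint), `Q(U₀)` (rows `hQtr`∕`hQsc`) and the slot `Δx U₀`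
(traceless row `hΔtr` + symmetry `hΔsymm` for the complement) — the UNITARY case of §1 `frakGT_comm`.
[cite: Balaban1985BackgroundPropagators, (3.153) p.426, p.393; Balaban1985Variational, (111) p.294, (51) p.286] -/
theorem trace_frakGT_toL2_eq_zero_of_traceless
    (Δx : GaugeField (F.P K) 0 (Matrix.specialUnitaryGroup (Fin 2) ℂ) → (BondL2K ℂ 3 (periodsT3 F K) c₀ W₂ →ₗ[ℂ] BondL2K ℂ 3 (periodsT3 F K) c₀ W₂))
    (hQtr : ∀ A : PBond (F.P K) 0 → Matrix (Fin 2) (Fin 2) ℂ, (∀ b, (A b).trace = 0) → ∀ c, (QTwS F n K h U₀ A c).trace = 0)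
    (hQsc : ∀ c : PBond (F.P K) 0 → ℂ, ∃ d : PBond (F.P n) 0 → ℂ, QTwS F n K h U₀ (fun b => c b • (1 : Matrix (Fin 2) (Fin 2) ℂ)) = fun c' => d c' • 1)
    (hΔtr : ∀ A : PBond (F.P K) 0 → Matrix (Fin 2) (Fin 2) ℂ, (∀ b, (A b).trace = 0) → ∀ b, ((toL2 F K c₀).symm (Δx U₀ (toL2 F K c₀ A)) b).trace = 0)
    (hΔsymm : (Δx U₀).IsSymmetric)
    (A : PBond (F.P K) 0 → Matrix (Fin 2) (Fin 2) ℂ) (hA : ∀ b, (A b).trace = 0) (b : PBond (F.P K) 0) :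
    ((toL2 F K c₀).symm (frakGT F n K h c₀ cB a Δx U₀ (toL2 F K c₀ A)) b).trace = 0 := by
  -- the traceless sectors of the three carriers
  let VE : Submodule ℂ (BondL2K ℂ 3 (periodsT3 F K) c₀ W₂) :=
    { carrier := {f | ∀ b, ((toL2 F K c₀).symm f b).trace = 0}
      add_mem' := fun {f g} hf hg b => by rw [map_add, Pi.add_apply, Matrix.trace_add, hf b, hg b, add_zero]
      zero_mem' := fun b => by rw [map_zero, Pi.zero_apply, Matrix.trace_zero]
      smul_mem' := fun r f hf b => by rw [map_smul, Pi.smul_apply, Matrix.trace_smul, hf b, smul_zero] }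
  let VS : Submodule ℂ (SiteL2K ℂ 3 (periodsT3 F K) c₀ W₂) :=
    { carrier := {g | ∀ x, ((toL2S F K c₀).symm g x).trace = 0}
      add_mem' := fun {f g} hf hg x => by rw [map_add, Pi.add_apply, Matrix.trace_add, hf x, hg x, add_zero]
      zero_mem' := fun x => by rw [map_zero, Pi.zero_apply, Matrix.trace_zero]
      smul_mem' := fun r f hf x => by rw [map_smul, Pi.smul_apply, Matrix.trace_smul, hf x, smul_zero] }
  let VF : Submodule ℂ (WL2 ℂ (fun _ : PBond (F.P n) 0 => cB) W₂) :=
    { carrier := {y | ∀ c, ((toL2B F n cB).symm y c).trace = 0}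
      add_mem' := fun {f g} hf hg c => by rw [map_add, Pi.add_apply, Matrix.trace_add, hf c, hg c, add_zero]
      zero_mem' := fun c => by rw [map_zero, Pi.zero_apply, Matrix.trace_zero]
      smul_mem' := fun r f hf c => by rw [map_smul, Pi.smul_apply, Matrix.trace_smul, hf c, smul_zero] }
  haveI : CompleteSpace VE := FiniteDimensional.complete ℂ VE
  haveI : CompleteSpace VS := FiniteDimensional.complete ℂ VS
  haveI : CompleteSpace VF := FiniteDimensional.complete ℂ VF
  -- membership through the route-carrier readings
  have memVE : ∀ A : PBond (F.P K) 0 → Matrix (Fin 2) (Fin 2) ℂ, toL2 F K c₀ A ∈ VE ↔ ∀ b, (A b).trace = 0 := fun A => by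
    change (∀ b, ((toL2 F K c₀).symm (toL2 F K c₀ A) b).trace = 0) ↔ _
    rw [LinearEquiv.symm_apply_apply]
  have memVF : ∀ B : PBond (F.P n) 0 → Matrix (Fin 2) (Fin 2) ℂ, toL2B F n cB B ∈ VF ↔ ∀ c, (B c).trace = 0 := fun B => by
    change (∀ c, ((toL2B F n cB).symm (toL2B F n cB B) c).trace = 0) ↔ _
    rw [LinearEquiv.symm_apply_apply]
  -- the complements: scalar-valued fields
  have scalar_mem_VFc : ∀ d : PBond (F.P n) 0 → ℂ, toL2B F n cB (fun c => d c • (1 : Matrix (Fin 2) (Fin 2) ℂ)) ∈ VFᗮ := by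
    intro d
    rw [Submodule.mem_orthogonal]
    intro v hv
    obtain ⟨B, rfl⟩ : ∃ B, v = toL2B F n cB B := ⟨(toL2B F n cB).symm v, ((toL2B F n cB).apply_symm_apply v).symm⟩
    rw [inner_toL2B]
    refine mul_eq_zero_of_right _ (Finset.sum_eq_zero fun c _ => trace_conjTranspose_mul_smul_one ((memVF B).1 hv c) (d c))
  have exists_scalar_of_mem_VEc : ∀ u ∈ VEᗮ, ∃ c : PBond (F.P K) 0 → ℂ, u = toL2 F K c₀ (fun b => c b • (1 : Matrix (Fin 2) (Fin 2) ℂ)) := by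
    intro u hu
    obtain ⟨A, rfl⟩ : ∃ A, u = toL2 F K c₀ A := ⟨(toL2 F K c₀).symm u, ((toL2 F K c₀).apply_symm_apply u).symm⟩
    have hpt : ∀ b, ∃ c : ℂ, A b = c • (1 : Matrix (Fin 2) (Fin 2) ℂ) := by
      intro b
      refine exists_smul_one_of_trace_orthogonal (A b) fun X hX => ?_
      have hmem : toL2 F K c₀ (Pi.single b X) ∈ VE := (memVE _).2 fun b' => by
        by_cases hb : b' = b
        · subst hb; rw [Pi.single_eq_same]; exact hX
        · rw [Pi.single_eq_of_ne hb, Matrix.trace_zero]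
      have h0 := (Submodule.mem_orthogonal _ _).1 hu _ hmem
      rw [inner_toL2, Finset.sum_eq_single b (fun b' _ hb' => by rw [Pi.single_eq_of_ne hb', Matrix.conjTranspose_zero, Matrix.zero_mul, Matrix.trace_zero])
        (fun hb => (hb (Finset.mem_univ b)).elim), Pi.single_eq_same] at h0
      have hc₀ : ((c₀ : ℝ) : ℂ) ≠ 0 := Complex.ofReal_ne_zero.2 (ne_of_gt (Fact.out : 0 < c₀))
      exact (mul_eq_zero.1 h0).resolve_left hc₀
    choose c hc using hpt
    exact ⟨c, congrArg _ (funext hc)⟩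
  -- DATA ROWS in sector form
  have hD_V : ∀ g ∈ VS, DL2 F n K c₀ U₀ g ∈ VE := by
    intro g hg
    obtain ⟨l, rfl⟩ : ∃ l, g = toL2S F K c₀ l := ⟨(toL2S F K c₀).symm g, ((toL2S F K c₀).apply_symm_apply g).symm⟩
    have hl : ∀ x, (l x).trace = 0 := fun x => by have := hg x; rwa [LinearEquiv.symm_apply_apply] at this
    exact fun b' => trace_DL2_apply_eq_zero U₀ l hl b'
  have hDstar_V : ∀ f ∈ VE, LinearMap.adjoint (DL2 F n K c₀ U₀) f ∈ VS := by
    intro f hf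
    obtain ⟨A, rfl⟩ : ∃ A, f = toL2 F K c₀ A := ⟨(toL2 F K c₀).symm f, ((toL2 F K c₀).apply_symm_apply f).symm⟩
    rw [adjoint_DL2]
    exact fun x => trace_DstarL2_apply_eq_zero F n K c₀ U₀ A ((memVE A).1 hf) x
  have hD_Vc : ∀ u ∈ VSᗮ, DL2 F n K c₀ U₀ u ∈ VEᗮ := fun u hu => mapsTo_orthogonal_of_adjoint _ VS VE hDstar_V hu
  have hQ_V : ∀ f ∈ VE, QL2 F n K h c₀ cB U₀ f ∈ VF := by
    intro f hf
    obtain ⟨A, rfl⟩ : ∃ A, f = toL2 F K c₀ A := ⟨(toL2 F K c₀).symm f, ((toL2 F K c₀).apply_symm_apply f).symm⟩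
    rw [QL2_toL2]
    exact (memVF _).2 (hQtr A ((memVE A).1 hf))
  have hQ_Vc : ∀ u ∈ VEᗮ, QL2 F n K h c₀ cB U₀ u ∈ VFᗮ := by
    intro u hu
    obtain ⟨c, rfl⟩ := exists_scalar_of_mem_VEc u hu
    obtain ⟨d, hd⟩ := hQsc c
    rw [QL2_toL2, hd]
    exact scalar_mem_VFc d
  have hΔ_V : ∀ f ∈ VE, (Δx U₀) f ∈ VE := by
    intro f hf
    obtain ⟨A, rfl⟩ : ∃ A, f = toL2 F K c₀ A := ⟨(toL2 F K c₀).symm f, ((toL2 F K c₀).apply_symm_apply f).symm⟩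
    exact fun b' => hΔtr A ((memVE A).1 hf) b'
  -- the slot is symmetric, so it preserves the complement of every sector it preserves
  have hΔ_Vc : ∀ u ∈ VEᗮ, (Δx U₀) u ∈ VEᗮ := fun u hu =>
    mapsTo_orthogonal_of_adjoint _ VE VE (fun v hv => by rw [hΔsymm.adjoint_eq]; exact hΔ_V v hv) hu
  -- the reflections intertwined by the data
  have hD : ∀ s, DL2 F n K c₀ U₀ (VS.reflection s) = VE.reflection (DL2 F n K c₀ U₀ s) := reflection_comm_of_mapsTo VS VE _ hD_V hD_Vc
  have hQ : ∀ x, QL2 F n K h c₀ cB U₀ (VE.reflection x) = VF.reflection (QL2 F n K h c₀ cB U₀ x) := reflection_comm_of_mapsTo VE VF _ hQ_V hQ_Vc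
  have hΔη : ∀ x, Δx U₀ (VE.reflection x) = VE.reflection (Δx U₀ x) := reflection_comm_of_mapsTo VE VE _ hΔ_V hΔ_Vc
  -- §1 at the unitary (reflection) triple
  have key := frakGT_comm F n K h c₀ cB a U₀ (fun x => VE.reflection x) (fun s => VS.reflection s) (fun y => VF.reflection y) Δx
    (Or.inr ⟨fun x y => VE.reflection.inner_map_map x y, fun x y => VS.reflection.inner_map_map x y, fun x y => VF.reflection.inner_map_map x y⟩)
    (fun x y => map_add _ x y) (fun x y => map_add _ x y) (fun x y => map_add _ x y)
    (fun x => VE.reflection_reflection x) (fun s => VS.reflection_reflection s) (fun y => VF.reflection_reflection y)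
    (fun r y => map_smul _ _ y) hD hQ hΔη (toL2 F K c₀ A)
  -- traceless `A` is fixed by `ρ_{V_E}`; hence so is `𝔊(toL2 A)`, i.e. it is traceless
  have hAmem : toL2 F K c₀ A ∈ VE := (memVE A).2 hA
  rw [Submodule.reflection_mem_subspace_eq_self hAmem] at key
  exact ((Submodule.reflection_eq_self_iff _).1 key.symm) b

/-! ## §4 The knit's (R-𝒢) clause for the reader of record `frakGfR` -/

section Reader

variable [Fact (0 < (F.L : ℝ))] [Fact (0 < ((F.L : ℝ)⁻¹) ^ (K - n))]
variable (Δx : GaugeField (F.P K) 0 (Matrix.specialUnitaryGroup (Fin 2) ℂ) → (BondL2K ℂ 3 (periodsT3 F K) c₀ W₂ →ₗ[ℂ] BondL2K ℂ 3 (periodsT3 F K) c₀ W₂))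

/-- **THE READER OF RECORD THROUGH THE ROUTE CARRIERS**: at lit-balaban's bond `x`, `(𝒢f f)(x) = toL2⁻¹(𝔊(U₀)(toL2 A))(bondEquiv⁻¹ x)` with `A := f ∘ bondEquiv` the (−3)-datum read on the
route's bonds (✓`jet_frakGfR_eq` + the `funEquiv`∕`toL2` dictionary ✓`toL2_symm_apply`). [cite: Balaban1985Variational, (111) p.294, (115)–(117) pp.294–295] -/
theorem jet_frakGfR_eq_toL2 (f : NegSize (F.L : ℝ) (((F.L : ℝ)⁻¹) ^ (K - n)) (fun _ : Bond 3 (periodsT3 F K) => K - n) 3 (Matrix (Fin 2) (Fin 2) ℂ))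
    (x : Bond 3 (periodsT3 F K)) :
    JetSup.equiv _ _ _ (frakGfR F n K h c₀ cB a Δx U₀ f) x =
      (toL2 F K c₀).symm (frakGT F n K h c₀ cB a Δx U₀ (toL2 F K c₀ (fun b => NegSup.equiv _ _ f (bondEquiv F K b)))) ((bondEquiv F K).symm x) := by
  -- the datum read on the route's bonds IS `funEquiv⁻¹` of the datum, through `toL2`
  have hA : (toL2 F K c₀).symm ((funEquiv frobEquiv (fun _ : Bond 3 (periodsT3 F K) => c₀)).symm (NegSup.equiv _ _ f)) =
      fun b => NegSup.equiv _ _ f (bondEquiv F K b) := by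
    funext b
    rw [toL2_symm_apply, funEquiv_symm_apply, LinearEquiv.apply_symm_apply]
  rw [jet_frakGfR_eq, ← hA, LinearEquiv.apply_symm_apply, funEquiv_apply, toL2_symm_apply, Equiv.apply_symm_apply]

/-- ★★★ **THE KNIT'S (R-𝒢) CLAUSE SHAPE AT ANY SLOT**: Hermitian traceless (−3)-data `f` give Hermitian traceless (115)-fields `𝒢f f` for the reader of record `frakGfR … Δx U₀`, given the `QTwS`
star-row `hQ` + sectors `hQtr`∕`hQsc` and the slot's σ-row `hΔx`, traceless row `hΔtr` and symmetry `hΔsymm` — the binder `h𝒢R` of ✓`stubEX_of_chartPiecesTwS3` at `𝒢f L i U₀ := frakGfR … Δx U₀`.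
[cite: Balaban1985Variational, (110)–(111) p.294, (115)–(117) pp.294–295, (51) p.286; Balaban1985BackgroundPropagators, (3.147) p.425, (3.153) p.426, p.393] -/
theorem frakGfR_isHermitian_traceless
    (hQ : ∀ A : PBond (F.P K) 0 → Matrix (Fin 2) (Fin 2) ℂ, QTwS F n K h U₀ (star A) = star (QTwS F n K h U₀ A))
    (hΔx : ∀ f : BondL2K ℂ 3 (periodsT3 F K) c₀ W₂, Δx U₀ (toL2 F K c₀ (star ((toL2 F K c₀).symm f))) = toL2 F K c₀ (star ((toL2 F K c₀).symm (Δx U₀ f))))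
    (hQtr : ∀ A : PBond (F.P K) 0 → Matrix (Fin 2) (Fin 2) ℂ, (∀ b, (A b).trace = 0) → ∀ c, (QTwS F n K h U₀ A c).trace = 0)
    (hQsc : ∀ c : PBond (F.P K) 0 → ℂ, ∃ d : PBond (F.P n) 0 → ℂ, QTwS F n K h U₀ (fun b => c b • (1 : Matrix (Fin 2) (Fin 2) ℂ)) = fun c' => d c' • 1)
    (hΔtr : ∀ A : PBond (F.P K) 0 → Matrix (Fin 2) (Fin 2) ℂ, (∀ b, (A b).trace = 0) → ∀ b, ((toL2 F K c₀).symm (Δx U₀ (toL2 F K c₀ A)) b).trace = 0)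
    (hΔsymm : (Δx U₀).IsSymmetric) :
    ∀ f : NegSize (F.L : ℝ) (((F.L : ℝ)⁻¹) ^ (K - n)) (fun _ : Bond 3 (periodsT3 F K) => K - n) 3 (Matrix (Fin 2) (Fin 2) ℂ),
      (∀ b, (NegSup.equiv _ _ f b).IsHermitian ∧ (NegSup.equiv _ _ f b).trace = 0) →
      ∀ b, (JetSup.equiv _ _ _ (frakGfR F n K h c₀ cB a Δx U₀ f) b).IsHermitian ∧ (JetSup.equiv _ _ _ (frakGfR F n K h c₀ cB a Δx U₀ f) b).trace = 0 := by
  intro f hf x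
  rw [jet_frakGfR_eq_toL2]
  exact ⟨frakGT_toL2_isHermitian_of_isHermitian F n K h c₀ cB a U₀ Δx hQ hΔx _ (fun b => (hf (bondEquiv F K b)).1) _,
    trace_frakGT_toL2_eq_zero_of_traceless F n K h c₀ cB a U₀ Δx hQtr hQsc hΔtr hΔsymm _ (fun b => (hf (bondEquiv F K b)).2) _⟩

/-- ★★★ **(R-𝒢) AT ANY SLOT, `U₀ ∈ 𝔘_k(ε₀)` IN THE WINDOWS `10⁹L²e ≤ 1`, `10¹²L³ε₀ ≤ 1` — the `QTwS` rows BY NAME** (★w5 ✓`QTwS_star_comm_of_regPr`∕`QTwS_traceless_of_regPr`∕`QTwS_scalar_of_regPr`):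
only the slot's three rows remain displayed. [cite: Balaban1985Variational, (110)–(111) p.294, (51) p.286; Balaban1985BackgroundPropagators, (3.153) p.426, p.393] -/
theorem frakGfR_isHermitian_traceless_at_regPr
    {ε₀ e : ℝ} (hε₀ : 0 < ε₀) (he : 0 < e) (hWe : 10 ^ 9 * (F.L : ℝ) ^ 2 * e ≤ 1) (hWε : 10 ^ 12 * (F.L : ℝ) ^ 3 * ε₀ ≤ 1) (hreg : RegPr F n K ε₀ U₀)
    (hΔx : ∀ f : BondL2K ℂ 3 (periodsT3 F K) c₀ W₂, Δx U₀ (toL2 F K c₀ (star ((toL2 F K c₀).symm f))) = toL2 F K c₀ (star ((toL2 F K c₀).symm (Δx U₀ f))))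
    (hΔtr : ∀ A : PBond (F.P K) 0 → Matrix (Fin 2) (Fin 2) ℂ, (∀ b, (A b).trace = 0) → ∀ b, ((toL2 F K c₀).symm (Δx U₀ (toL2 F K c₀ A)) b).trace = 0)
    (hΔsymm : (Δx U₀).IsSymmetric) :
    ∀ f : NegSize (F.L : ℝ) (((F.L : ℝ)⁻¹) ^ (K - n)) (fun _ : Bond 3 (periodsT3 F K) => K - n) 3 (Matrix (Fin 2) (Fin 2) ℂ),
      (∀ b, (NegSup.equiv _ _ f b).IsHermitian ∧ (NegSup.equiv _ _ f b).trace = 0) →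
      ∀ b, (JetSup.equiv _ _ _ (frakGfR F n K h c₀ cB a Δx U₀ f) b).IsHermitian ∧ (JetSup.equiv _ _ _ (frakGfR F n K h c₀ cB a Δx U₀ f) b).trace = 0 :=
  frakGfR_isHermitian_traceless F n K h c₀ cB a U₀ Δx (QTwS_star_comm_of_regPr F h hε₀ he hWe hWε U₀ hreg) hΔx (QTwS_traceless_of_regPr F h hε₀ he hWe hWε U₀ hreg)
    (QTwS_scalar_of_regPr F h hε₀ hWε U₀ hreg) hΔtr hΔsymm

/-- ★★★ **(R-𝒢) AT THE SLOT `Δ^η` (`DeltaEtaSlot`) — UNCONDITIONAL** at `U₀ ∈ 𝔘_k(ε₀)` in the windows: the slot rows are p01's ✓`DeltaEta_toL2_star`, ✓`DeltaEta_isSymmetric` and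
✓`Prop7WilsonHessianSectorRows.trace_DeltaEta_toL2_eq_zero`. [cite: Balaban1985Variational, (110)–(111) p.294, (51) p.286; Balaban1985BackgroundPropagators, (3.12) p.392, (3.153) p.426] -/
theorem frakGfR_isHermitian_traceless_at_regPr_DeltaEtaSlot
    {ε₀ e : ℝ} (hε₀ : 0 < ε₀) (he : 0 < e) (hWe : 10 ^ 9 * (F.L : ℝ) ^ 2 * e ≤ 1) (hWε : 10 ^ 12 * (F.L : ℝ) ^ 3 * ε₀ ≤ 1) (hreg : RegPr F n K ε₀ U₀) :
    ∀ f : NegSize (F.L : ℝ) (((F.L : ℝ)⁻¹) ^ (K - n)) (fun _ : Bond 3 (periodsT3 F K) => K - n) 3 (Matrix (Fin 2) (Fin 2) ℂ),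
      (∀ b, (NegSup.equiv _ _ f b).IsHermitian ∧ (NegSup.equiv _ _ f b).trace = 0) →
      ∀ b, (JetSup.equiv _ _ _ (frakGfR F n K h c₀ cB a (DeltaEtaSlot F n K c₀) U₀ f) b).IsHermitian ∧
        (JetSup.equiv _ _ _ (frakGfR F n K h c₀ cB a (DeltaEtaSlot F n K c₀) U₀ f) b).trace = 0 :=
  frakGfR_isHermitian_traceless_at_regPr F n K h c₀ cB a U₀ (DeltaEtaSlot F n K c₀) hε₀ he hWe hWε hreg
    (fun f => by have key := DeltaEta_toL2_star (F := F) (n := n) (K := K) (c₀ := c₀) U₀ ((toL2 F K c₀).symm f); rwa [LinearEquiv.apply_symm_apply] at key)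
    (fun A hA b => trace_DeltaEta_toL2_eq_zero U₀ A hA b) (DeltaEta_isSymmetric U₀)

end Reader

end Summit.QuantumFields.YangMills.Theorems.Prop7FrakGReality

end
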